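import Summits.QuantumFields.BalabanUV.Beta.FP.DirectionalDoorKernelLaw

/-!
# `BalabanUV.Beta.FP.DirectionalJetShapes` — road «FP» for binder row D1, ROUTE T, THE LEVEL-0 ASSEMBLY, STEP 1 (memo `N2B-DESIGN.md` (32e)): **THE DOOR's
# NON-TABLE JET SHAPES ARE LINEAR ∕ BILINEAR IN THE DIRECTION** — the gauge-shifted weight `h + Dλ`, the `Matrix.of`-weighted generator jets (`W₁ W′₁ W₂ W′₂ Db₁`
# shapes), the diagonal transport generators (`X X̄` shapes) and the parameter-transport generator (`C₁` shape), in #33's one-hypothesis currency (OWNER #34)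

WHY.  #33 `DirectionalDoorKernelLaw.mixedVar_kernel_law_of_directional_door` asks ONE linearity hypothesis per jet slot; for the TABLE families of the door
(`Σ_b h b • T_b`, `Σ_{b,b′} h b·h b′ • T_{bb′}`) #33 §4 `lin_sum_smul ∕ bilin_sum_sum_smul_*` are the instances, and for the dressed coarse words #32.  The door's
REMAINING jets (U20∕U21∕U22's `hW₁ hDb₁ hW₂ hW′₁ hW′₂ hX hXbar hC₁`, and the weights `h b + Σ_s tgrad b s·λ s` inside `hH′₁ hH′₂ h𝔔′₁ h𝔔′₂`) are entrywise
(`Matrix.of`, `Matrix.diagonal`, `Matrix.fromBlocks`) expressions in the direction; this file proves their (bi)linearity ONCE, over ARBITRARY index types and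
ARBITRARY coefficient functions (the consumer instantiates `S b e := Sum.elim (tdelta M′ …) (tdelta (fine Lc M′) …) e`, `D := tgrad`, etc.), so the concrete
assembly's per-jet lemmas are one-line instances whatever the U-file's index bookkeeping:
* §1 `lin_shift` (the gauge-shifted weight `v ↦ v.1 + D·v.2` on `(β → ℝ) × (γ → ℝ)`), `lin_ofWeighted` (`v ↦ of (b e ↦ κ·(w v) b·S b e)` for linear `w`),
  `lin_negDiagonal_comp ∕ lin_smulDiagonal_sum` (the `X ∕ X̄` shapes), `lin_fromBlocks₄` (a block matrix of four linear jets is linear — the `C₁` shape with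
  `lin_diagonal_fun`, `lin_of_fun`);
* §2 `bilin_ofWeighted₂_left ∕ _right` (`(v, v′) ↦ of (b e ↦ κ·(w v) b·(w v′) b·S b e)` — the POLARISED square-law generator jets `W₂ ∕ W′₂`; on the diagonal
  `(κ·(w v) b)²·S b e` by `ring`, lemma `ofWeighted₂_diag`).
[folklore] entrywise algebra; no `def`, no `def … : Prop`, nothing cited, 0 sorry; 0 estimates.  NOT HERE: any U21 binder, the dressed words (#32), the table
families (#33 §4), the door itself.

HONEST DEPENDENCY (page 1, mandatory): continuum YM on T⁴ ⇐ BetaPertH ∧ nine spine estimates (0/9 proved); BetaPertH ⇐ (D1) ∧ (D4) ∧ CAP+tail;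
G-an2-4 gates asym, D1 and NE2/3/4.  HONEST FRAMING (cell contract, verbatim): «discharging `BetaPertH` makes Bałaban's UV stability UNCONDITIONAL —
a real constructive-QFT result; it is NOT the continuum limit and NOT the Clay problem.»  ABSOLUTE RULE (cell charter, verbatim): «No internally-minted
statement may enter as a cited fact. Every hypothesis is either kernel-proved in this package or a verbatim quotation of a PUBLISHED theorem with page
reference. The manuscript(s) under audit are NOT citable for their own disputed steps — they are the thing under adjudication; programme-internal
(2001/route/tribunal) claims are never citable.»  [folklore]; nothing of Bałaban's asserted; 0 estimates; 0∕4 row-D1 binders (hW, hR, D1Tel, D1Rep);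
NOT (T-ID), NOT SDF, NOT D1, NOT BetaPertH, NOT continuum, NOT Clay.  Road «FP» OWNER, b2b-balaban-beta-d1-p3 gen 24, 2026-08-23.  No existing file touched.
-/

noncomputable section

open scoped BigOperators Matrix

namespace Summit.QuantumFields.BalabanUV.Beta.FP.DirectionalJetShapes

open Matrix

/-! ## §1 Order 1: shifted weights, weighted generator jets, diagonal and block generators -/

section OrderOne

variable {V β γ ε : Type*} [AddCommGroup V] [Module ℝ V]

/-- [folklore] **THE GAUGE-SHIFTED WEIGHT IS LINEAR**: on `V = (β → ℝ) × (γ → ℝ)` (a pair `(h, λ)`), `v ↦ (b ↦ v.1 b + Σ_s D b s · v.2 s)` — U20∕U21's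
`h b + Σ_s tgrad (fine Lc M′) (b.1, inl b.2) s * lam s` — satisfies the one-hypothesis linearity. -/
theorem lin_shift [Fintype γ] (D : β → γ → ℝ) (c : ℝ) (x y : (β → ℝ) × (γ → ℝ)) :
    (fun b => (c • x + y).1 b + ∑ s, D b s * (c • x + y).2 s)
      = c • (fun b => x.1 b + ∑ s, D b s * x.2 s) + (fun b => y.1 b + ∑ s, D b s * y.2 s) := by
  funext b
  simp only [Prod.fst_add, Prod.snd_add, Prod.smul_fst, Prod.smul_snd, Pi.add_apply, Pi.smul_apply, smul_eq_mul]
  rw [show (∑ s, D b s * (c * x.2 s + y.2 s)) = c * (∑ s, D b s * x.2 s) + ∑ s, D b s * y.2 s by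
    rw [Finset.mul_sum, ← Finset.sum_add_distrib]; exact Finset.sum_congr rfl fun _ _ => by ring]
  ring

/-- [folklore] **A `Matrix.of`-WEIGHTED GENERATOR JET IS LINEAR**: for a linear weight `w : V → (β → ℝ)` and fixed coefficients `κ`, `S`,
`v ↦ of (b e ↦ κ · (w v) b · S b e)` is linear — U20∕U21's `hW₁ ∕ hDb₁ ∕ hW′₁` shapes (after `Σ_b h b • of (b′ e ↦ if b′ = b then … else 0) = of (b e ↦ h b · …)`). -/
theorem lin_ofWeighted (κ : ℝ) (S : β → ε → ℝ) (w : V → (β → ℝ)) (hw : ∀ (c : ℝ) (x y : V), w (c • x + y) = c • w x + w y)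
    (c : ℝ) (x y : V) :
    (Matrix.of fun b e => κ * w (c • x + y) b * S b e)
      = c • (Matrix.of fun b e => κ * w x b * S b e) + Matrix.of fun b e => κ * w y b * S b e := by
  ext b e
  simp only [hw, Matrix.of_apply, Matrix.add_apply, Matrix.smul_apply, Pi.add_apply, Pi.smul_apply, smul_eq_mul]
  ring

/-- [folklore] **THE WEIGHTED INDICATOR FAMILY IS A `Matrix.of`**: `Σ_b h b • of (b′ e ↦ if b′ = b then F b e else 0) = of (b e ↦ h b · F b e)` — the bridge
from U20∕U21's `hW₁` spelling to `lin_ofWeighted`'s. -/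
theorem sum_smul_of_ite_eq [Fintype β] [DecidableEq β] (h : β → ℝ) (F : β → ε → ℝ) :
    (∑ b, h b • Matrix.of (fun (b' : β) (e : ε) => if b' = b then F b e else 0)) = Matrix.of fun b e => h b * F b e := by
  ext b e
  simp only [Matrix.sum_apply, Matrix.smul_apply, Matrix.of_apply, smul_eq_mul, mul_ite, mul_zero]
  rw [Finset.sum_eq_single b (fun b' _ hb' => if_neg (Ne.symm hb')) (fun h => (h (Finset.mem_univ b)).elim), if_pos rfl]

/-- [folklore] **THE FIELD TRANSPORT GENERATOR IS LINEAR** (U20∕U21's `hX : X = −(c • diagonal (fun b => lam b.1))`): for a linear weight `w : V → (γ → ℝ)` and a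
projection `pr : β → γ`, `v ↦ −(κ • diagonal ((w v) ∘ pr))` is linear. -/
theorem lin_negDiagonal_comp [DecidableEq β] (κ : ℝ) (pr : β → γ) (w : V → (γ → ℝ)) (hw : ∀ (c : ℝ) (x y : V), w (c • x + y) = c • w x + w y)
    (c : ℝ) (x y : V) :
    -(κ • Matrix.diagonal (fun b : β => w (c • x + y) (pr b)))
      = c • (-(κ • Matrix.diagonal (fun b : β => w x (pr b)))) + -(κ • Matrix.diagonal (fun b : β => w y (pr b))) := by
  ext i j
  by_cases hij : i = j
  · subst hij; simp [hw]; ring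
  · simp [hij]

/-- [folklore] **THE COMPOSITE-MULTIPLIER TRANSPORT GENERATOR IS LINEAR** (U20∕U21's `hXbar : Xbar = c • diagonal (fun α => Σ_t A α t * Σ_s B t s * lam s)`): for a
linear weight `w`, `v ↦ κ • diagonal (α ↦ Σ_t A α t · Σ_s B t s · (w v) s)` is linear. -/
theorem lin_smulDiagonal_sum {α τ : Type*} [DecidableEq α] [Fintype τ] [Fintype γ] (κ : ℝ) (A : α → τ → ℝ) (B : τ → γ → ℝ)
    (w : V → (γ → ℝ)) (hw : ∀ (c : ℝ) (x y : V), w (c • x + y) = c • w x + w y) (c : ℝ) (x y : V) :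
    κ • Matrix.diagonal (fun a : α => ∑ t, A a t * ∑ s, B t s * w (c • x + y) s)
      = c • (κ • Matrix.diagonal (fun a : α => ∑ t, A a t * ∑ s, B t s * w x s)) + κ • Matrix.diagonal (fun a : α => ∑ t, A a t * ∑ s, B t s * w y s) := by
  ext i j
  by_cases hij : i = j
  · subst hij
    simp only [hw, Matrix.smul_apply, Matrix.diagonal_apply_eq, Matrix.add_apply, Pi.add_apply, Pi.smul_apply, smul_eq_mul, mul_add,
      Finset.sum_add_distrib, Finset.mul_sum]
    congr 1
    all_goals exact Finset.sum_congr rfl fun _ _ => Finset.sum_congr rfl fun _ _ => by ring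
  · simp [hij]

/-- [folklore] **A DIAGONAL OF A LINEAR SCALAR FAMILY IS LINEAR** (`diagonal (a ↦ f v a)` for `f` linear pointwise). -/
theorem lin_diagonal_fun {α : Type*} [DecidableEq α] (f : V → α → ℝ) (hf : ∀ (c : ℝ) (x y : V), f (c • x + y) = c • f x + f y) (c : ℝ) (x y : V) :
    Matrix.diagonal (f (c • x + y)) = c • Matrix.diagonal (f x) + Matrix.diagonal (f y) := by
  ext i j
  by_cases h : i = j
  · subst h; simp [hf]
  · simp [hf, h]

/-- [folklore] **A `Matrix.of` OF A LINEAR ENTRY FAMILY IS LINEAR.** -/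
theorem lin_of_fun {α δ : Type*} (f : V → α → δ → ℝ) (hf : ∀ (c : ℝ) (x y : V), f (c • x + y) = c • f x + f y) (c : ℝ) (x y : V) :
    Matrix.of (f (c • x + y)) = c • Matrix.of (f x) + Matrix.of (f y) := by
  rw [hf]; rfl

/-- [folklore] **A BLOCK MATRIX OF FOUR LINEAR JETS IS LINEAR** (the parameter-transport generator `C₁(λ) = fromBlocks (diagonal …) 0 (of …) (diagonal …)` of
leaf-06's `hC₁`: its blocks are `diagonal` ∕ `of` ∕ `0` of entry families linear in `λ`). -/
theorem lin_fromBlocks₄ {m n p q : Type*} (A : V → Matrix m p ℝ) (B : V → Matrix m q ℝ) (C : V → Matrix n p ℝ) (D : V → Matrix n q ℝ)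
    (hA : ∀ (c : ℝ) (x y : V), A (c • x + y) = c • A x + A y) (hB : ∀ (c : ℝ) (x y : V), B (c • x + y) = c • B x + B y)
    (hC : ∀ (c : ℝ) (x y : V), C (c • x + y) = c • C x + C y) (hD : ∀ (c : ℝ) (x y : V), D (c • x + y) = c • D x + D y) (c : ℝ) (x y : V) :
    Matrix.fromBlocks (A (c • x + y)) (B (c • x + y)) (C (c • x + y)) (D (c • x + y))
      = c • Matrix.fromBlocks (A x) (B x) (C x) (D x) + Matrix.fromBlocks (A y) (B y) (C y) (D y) := by
  rw [hA, hB, hC, hD, Matrix.fromBlocks_smul, Matrix.fromBlocks_add]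

/-- [folklore] The constant-zero block is linear (for `lin_fromBlocks₄`'s `0` block). -/
theorem lin_zero {M : Type*} [AddCommGroup M] [Module ℝ M] (c : ℝ) (x y : V) :
    (fun _ : V => (0 : M)) (c • x + y) = c • (fun _ : V => (0 : M)) x + (fun _ : V => (0 : M)) y := by
  simp

end OrderOne

/-! ## §2 Order 2: the polarised square-law generator jets -/

section OrderTwo

variable {V β ε : Type*} [AddCommGroup V] [Module ℝ V]

/-- [folklore] **THE POLARISED SQUARE-LAW GENERATOR JET IS LINEAR IN ITS LEFT DIRECTION**: for a linear weight `w`,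
`(v, v′) ↦ of (b e ↦ (κ·(w v) b)·(κ·(w v′) b)·S b e)` — U20∕U21's `hW₂ ∕ hW′₂` (`(κ·h b)²·S b e` on the diagonal) POLARISED. -/
theorem bilin_ofWeighted₂_left (κ : ℝ) (S : β → ε → ℝ) (w : V → (β → ℝ)) (hw : ∀ (c : ℝ) (x y : V), w (c • x + y) = c • w x + w y)
    (c : ℝ) (x y z : V) :
    (Matrix.of fun b e => (κ * w (c • x + y) b) * (κ * w z b) * S b e)
      = c • (Matrix.of fun b e => (κ * w x b) * (κ * w z b) * S b e) + Matrix.of fun b e => (κ * w y b) * (κ * w z b) * S b e := by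
  ext b e
  simp only [hw, Matrix.of_apply, Matrix.add_apply, Matrix.smul_apply, Pi.add_apply, Pi.smul_apply, smul_eq_mul]
  ring

/-- [folklore] … and IN ITS RIGHT DIRECTION. -/
theorem bilin_ofWeighted₂_right (κ : ℝ) (S : β → ε → ℝ) (w : V → (β → ℝ)) (hw : ∀ (c : ℝ) (x y : V), w (c • x + y) = c • w x + w y)
    (c : ℝ) (x y z : V) :
    (Matrix.of fun b e => (κ * w z b) * (κ * w (c • x + y) b) * S b e)
      = c • (Matrix.of fun b e => (κ * w z b) * (κ * w x b) * S b e) + Matrix.of fun b e => (κ * w z b) * (κ * w y b) * S b e := by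
  ext b e
  simp only [hw, Matrix.of_apply, Matrix.add_apply, Matrix.smul_apply, Pi.add_apply, Pi.smul_apply, smul_eq_mul]
  ring

/-- [folklore] **ON THE DIAGONAL THE POLARISED JET IS THE DOOR's SQUARE-LAW JET**: `of (b e ↦ (κ·w b)·(κ·w b)·S b e) = of (b e ↦ (κ·w b)^2·S b e)`. -/
theorem ofWeighted₂_diag (κ : ℝ) (S : β → ε → ℝ) (w : β → ℝ) :
    (Matrix.of fun b e => (κ * w b) * (κ * w b) * S b e) = Matrix.of fun b e => (κ * w b) ^ 2 * S b e := by
  ext b e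
  simp only [Matrix.of_apply]
  ring

end OrderTwo

end Summit.QuantumFields.BalabanUV.Beta.FP.DirectionalJetShapes

end
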